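import Literature.AlgebraicGeometry.PlaneCurves.HessePencilPointsOfOrderNine
import Literature.AlgebraicGeometry.PlaneCurves.WeierstrassNineFlexes
import HarnessLib

/-!
# `E[3] = {aT₁ + bT₃}`: the nine base points are the whole `3`-torsion, and Prop. 5.2's first assertion as an equivalence (Artebani–Dolgachev §2, §4, Prop. 5.2)

Topic `Literature/AlgebraicGeometry/PlaneCurves`, namespace `Literature.AlgebraicGeometry.PlaneCurves`.
Lane `lit-hodgefound`, seat `lit-hodgefound-p37`, row g20-#5; the sequel of `HessePencilGroupLaw`
(g20-#3: the table (matrix2), `N vec (aT₁ + bT₃) ∥ p_{a+3b}`) and `HessePencilPointsOfOrderNine`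
(g20-#4: `Bᵢ(p) = 0 ↔ 3P + (aT₁ + bT₃) = O`), which both listed "`E[3] = ⟨T₁, T₃⟩` needs `K = K̄`"
as NOT there.  Everything is PROVED; no definition, no named fact.

Source followed — M. Artebani, I. Dolgachev, *The Hesse pencil of plane cubic curves*,
L'Enseignement Math. (2) 55 (2009) 235–273 [arXiv:math/0611590, held `paper:arxiv-math_0611590`],
VERBATIM: §2 (p0004): "the group of 3-torsion points of `E_λ` is equal to the set of inflection
points, which we rewrite in matrix form as (matrix2)"; §4 (p0008): "The subgroup `Γ` generated by
`g₁` and `g₂` induces the group of translations `E[3] ≅ (ℤ/3ℤ)²`"; §5, Prop. 5.2 (p0010): "The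
union of the eight cubics `Bᵢ` cuts out on each nonsingular member of the Hesse pencil the set of
points of order `9` in the group law with the point `p₀` as the origin."

## What is here

* §1 (any additive group) `torsion_pair_eq_zero`, `torsion_pair_injective`, `neg_torsion_pair`: if `3T₁ = 3T₃ = O`
  and the eight combinations `aT₁ + bT₃`, `(a, b) ≠ (0, 0)`, are `≠ O`, then
  `(a, b) ↦ aT₁ + bT₃` is injective on `{0,1,2}²` — nine distinct points.
* §2 (`K` any field, `3 ≠ 0`, `μ³ ≠ 1`, `ω² + ω + 1 = 0`) `hesse_torsion_pair_injective`: the nine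
  points `aT₁ + bT₃` of `W_μ(K)` over the nine base points are pairwise distinct (g20-#3, g20-#4).
* §3 (`K = K̄`) **`E[3] = {aT₁ + bT₃}`** (`hesse_three_torsion_eq`): every `R ∈ W_μ(K̄)` with
  `3R = O` is `aT₁ + bT₃` for a unique `(a, b) ∈ {0,1,2}²` — nine distinct `3`-torsion points inside
  `#W_μ(K̄)[3] = 9` (`card_torsionBy_three`, Silverman–Tate 2.1 (d), `WeierstrassNineFlexes`).
* §4 (`K = K̄`) **Prop. 5.2, first assertion, as an equivalence** (`hesse_addOrderOf_eq_nine_iff`):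
  `P ∈ W_μ(K̄)` has order `9` iff its Hesse point `N vec P` lies on `B₁ ∪ ⋯ ∪ B₈`.

## References
* [ArtebaniDolgachev2009] M. Artebani, I. Dolgachev, *The Hesse pencil of plane cubic curves*,
  Enseign. Math. (2) 55 (2009) 235–273, §2 (matrix2), §4, §5 Prop. 5.2.
* [SilvermanTate2015] J. H. Silverman, J. Tate, *Rational Points on Elliptic Curves*, 2nd ed.,
  Springer 2015, §2.1, Thm. 2.1 (d) (`#E[3] = 9`).
-/

set_option autoImplicit false

open MvPolynomial Matrix

namespace Literature.AlgebraicGeometry.PlaneCurves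

universe u

/-- The Weierstrass model `W_μ` of `H_μ` (local notation). -/
local notation3 "𝐖[" μ "]" =>
  ({ a₁ := -μ, a₂ := -μ ^ 2, a₃ := (μ ^ 3 - 1) / 3, a₄ := μ * (μ ^ 3 - 1) / 3,
     a₆ := -(μ ^ 3 - 1) ^ 2 / 27 } : WeierstrassCurve _)

/-- `N_μ` (g20-#3; local notation). -/
local notation3 "𝐍[" μ "]" =>
  (Matrix.of ![![1, 0, 0], ![-μ, 1, (μ ^ 3 - 1) / 3], ![0, -1, 0]] : Matrix (Fin 3) (Fin 3) _)

/-- The eight cubics of Prop. 5.2, as printed (local notations, no definitions). -/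
local notation3 "𝐁₁[" ω "]" => (X 0 ^ 3 + C ω * X 1 ^ 3 + C (ω ^ 2) * X 2 ^ 3 : MvPolynomial (Fin 3) _)
local notation3 "𝐁₅[" ω "]" => (X 0 ^ 3 + C (ω ^ 2) * X 1 ^ 3 + C ω * X 2 ^ 3 : MvPolynomial (Fin 3) _)
local notation3 "𝐁₂" => (X 0 ^ 2 * X 1 + X 1 ^ 2 * X 2 + X 2 ^ 2 * X 0 : MvPolynomial (Fin 3) _)
local notation3 "𝐁₆" => (X 0 ^ 2 * X 2 + X 1 ^ 2 * X 0 + X 2 ^ 2 * X 1 : MvPolynomial (Fin 3) _)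
local notation3 "𝐁₃[" ω "]" =>
  (X 0 ^ 2 * X 1 + C (ω ^ 2) * (X 1 ^ 2 * X 2) + C ω * (X 2 ^ 2 * X 0) : MvPolynomial (Fin 3) _)
local notation3 "𝐁₇[" ω "]" =>
  (X 0 ^ 2 * X 2 + C ω * (X 1 ^ 2 * X 0) + C (ω ^ 2) * (X 2 ^ 2 * X 1) : MvPolynomial (Fin 3) _)
local notation3 "𝐁₄[" ω "]" =>
  (X 0 ^ 2 * X 1 + C ω * (X 1 ^ 2 * X 2) + C (ω ^ 2) * (X 2 ^ 2 * X 0) : MvPolynomial (Fin 3) _)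
local notation3 "𝐁₈[" ω "]" =>
  (X 0 ^ 2 * X 2 + C (ω ^ 2) * (X 1 ^ 2 * X 0) + C ω * (X 2 ^ 2 * X 1) : MvPolynomial (Fin 3) _)

/-! ## §1 Nine distinct points from two independent `3`-torsion points (any additive group) -/

section Group

variable {A : Type u} [AddCommGroup A] {T₁ T₃ : A}

/-- If the eight combinations `aT₁ + bT₃`, `(a, b) ∈ {0,1,2}² ∖ {(0,0)}`, are non-zero, then
`rT₁ + sT₃ = O` with `r, s < 3` forces `r = s = 0`. [cite: ArtebaniDolgachev2009, §2 (matrix2: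
the nine base points are nine distinct `3`-torsion points)] -/
theorem torsion_pair_eq_zero (n₁ : T₁ ≠ 0) (n₂ : 2 • T₁ ≠ 0) (n₃ : T₃ ≠ 0) (n₄ : T₁ + T₃ ≠ 0)
    (n₅ : 2 • T₁ + T₃ ≠ 0) (n₆ : 2 • T₃ ≠ 0) (n₇ : T₁ + 2 • T₃ ≠ 0) (n₈ : 2 • T₁ + 2 • T₃ ≠ 0)
    {r s : ℕ} (hr : r < 3) (hs : s < 3) (h : r • T₁ + s • T₃ = 0) : r = 0 ∧ s = 0 := by
  interval_cases r <;> interval_cases s <;> simp_all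

/-- **Nine distinct points**: with `3T₁ = 3T₃ = O` and the eight non-vanishings, `(a, b) ↦ aT₁ + bT₃`
is injective on `{0,1,2}²`. [cite: ArtebaniDolgachev2009, §2 (matrix2), §4 (`E[3] ≅ (ℤ/3ℤ)²`)] -/
theorem torsion_pair_injective (h₁ : 3 • T₁ = 0) (h₃ : 3 • T₃ = 0)
    (n₁ : T₁ ≠ 0) (n₂ : 2 • T₁ ≠ 0) (n₃ : T₃ ≠ 0) (n₄ : T₁ + T₃ ≠ 0)
    (n₅ : 2 • T₁ + T₃ ≠ 0) (n₆ : 2 • T₃ ≠ 0) (n₇ : T₁ + 2 • T₃ ≠ 0) (n₈ : 2 • T₁ + 2 • T₃ ≠ 0)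
    {a b a' b' : ℕ} (ha : a < 3) (hb : b < 3) (ha' : a' < 3) (hb' : b' < 3)
    (h : a • T₁ + b • T₃ = a' • T₁ + b' • T₃) : a = a' ∧ b = b' := by
  -- add `(3 − a')T₁ + (3 − b')T₃` to both sides
  have key : (a + (3 - a')) • T₁ + (b + (3 - b')) • T₃ = 0 := by
    have e : (a + (3 - a')) • T₁ + (b + (3 - b')) • T₃ =
        (a • T₁ + b • T₃) + ((3 - a') • T₁ + (3 - b') • T₃) := by
      rw [add_nsmul, add_nsmul]; abel
    have e' : (a' • T₁ + b' • T₃) + ((3 - a') • T₁ + (3 - b') • T₃) =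
        (a' + (3 - a')) • T₁ + (b' + (3 - b')) • T₃ := by
      rw [add_nsmul, add_nsmul]; abel
    rw [e, h, e', Nat.add_sub_cancel' ha'.le, Nat.add_sub_cancel' hb'.le, h₁, h₃, add_zero]
  rw [nsmul_eq_mod_nsmul (a + (3 - a')) h₁, nsmul_eq_mod_nsmul (b + (3 - b')) h₃] at key
  obtain ⟨hr, hs⟩ := torsion_pair_eq_zero n₁ n₂ n₃ n₄ n₅ n₆ n₇ n₈ (Nat.mod_lt _ three_pos)
    (Nat.mod_lt _ three_pos) key
  omega

/-- With `3T₁ = 3T₃ = O`: `−(aT₁ + bT₃) = ((3 − a) mod 3)T₁ + ((3 − b) mod 3)T₃` — the inverse in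
`(ℤ/3ℤ)²`. [cite: ArtebaniDolgachev2009, §4 (`E[3] ≅ (ℤ/3ℤ)²`)] -/
theorem neg_torsion_pair (h₁ : 3 • T₁ = 0) (h₃ : 3 • T₃ = 0) {a b : ℕ} (ha : a < 3) (hb : b < 3) :
    -(a • T₁ + b • T₃) = ((3 - a) % 3) • T₁ + ((3 - b) % 3) • T₃ := by
  rw [← nsmul_eq_mod_nsmul (3 - a) h₁, ← nsmul_eq_mod_nsmul (3 - b) h₃, neg_eq_iff_add_eq_zero,
    show a • T₁ + b • T₃ + ((3 - a) • T₁ + (3 - b) • T₃) = (a + (3 - a)) • T₁ + (b + (3 - b)) • T₃ by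
      rw [add_nsmul, add_nsmul]; abel,
    Nat.add_sub_cancel' ha.le, Nat.add_sub_cancel' hb.le, h₁, h₃, add_zero]

end Group

section Hesse

variable {K : Type u} [Field K] {μ : K} (vec : (𝐖[μ] : WeierstrassCurve K).toAffine.Point → Fin 3 → K)
variable {ω : K} {T₁ T₃ : (𝐖[μ] : WeierstrassCurve K).toAffine.Point} {c₁ c₃ : K}

/-! ## §2 The nine points over the base points are distinct (any field) -/

/-- **The nine points `aT₁ + bT₃` of `W_μ(K)` over the nine base points `p_{a+3b}` are pairwise
distinct** (`3 ≠ 0`, `μ³ ≠ 1`, `ω² + ω + 1 = 0`; `T₁, T₃` over `p₁ = (0,1,−ε)`, `p₃ = (1,0,−1)`).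
[cite: ArtebaniDolgachev2009, §2 ("the group of 3-torsion points … is equal to the set of
inflection points, which we rewrite in matrix form as (matrix2)")] -/
theorem hesse_torsion_pair_injective [DecidableEq K] (h3 : (3 : K) ≠ 0) (hμ : μ ^ 3 ≠ 1)
    (hω : ω ^ 2 + ω + 1 = 0) (hv0 : vec 0 = ![0, 1, 0])
    (hvs : ∀ x y (h : (𝐖[μ] : WeierstrassCurve K).toAffine.Nonsingular x y), vec (.some x y h) = ![x, y, 1])
    (hc₁ : c₁ ≠ 0) (hT₁ : (𝐍[μ] : Matrix (Fin 3) (Fin 3) K) *ᵥ vec T₁ = c₁ • ![(0 : K), 1, -ω])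
    (hc₃ : c₃ ≠ 0) (hT₃ : (𝐍[μ] : Matrix (Fin 3) (Fin 3) K) *ᵥ vec T₃ = c₃ • ![(1 : K), 0, -1])
    {a b a' b' : ℕ} (ha : a < 3) (hb : b < 3) (ha' : a' < 3) (hb' : b' < 3)
    (h : a • T₁ + b • T₃ = a' • T₁ + b' • T₃) : a = a' ∧ b = b' := by
  have h3ω : ω ^ 3 = 1 := by linear_combination (ω - 1) * hω
  obtain ⟨n₁, n₂, n₃, n₄, n₅, n₆, n₇, n₈⟩ := hesse_torsion_ne_zero vec h3 hμ hω hv0 hvs hc₁ hT₁ hc₃ hT₃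
  exact torsion_pair_injective (three_nsmul_T₁ vec h3 hμ h3ω hv0 hvs hc₁ hT₁)
    (three_nsmul_T₃ vec h3 hμ hv0 hvs hc₃ hT₃) n₁ n₂ n₃ n₄ n₅ n₆ n₇ n₈ ha hb ha' hb' h

/-! ## §3 `E[3] = {aT₁ + bT₃}` over an algebraically closed field -/

open scoped Classical in
/-- **`E[3] = ⟨T₁, T₃⟩ = {aT₁ + bT₃ : a, b ∈ {0,1,2}}`** over `K = K̄` (`3 ≠ 0`, `μ³ ≠ 1`,
`ω² + ω + 1 = 0`): every `R ∈ W_μ(K̄)` with `3R = O` is `aT₁ + bT₃` with `a, b < 3` — the nine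
distinct points of §2 exhaust `#W_μ(K̄)[3] = 9` (`card_torsionBy_three`; `W_μ` is elliptic as
`μ³ ≠ 1`, `hesse_weierstrass_isElliptic_iff`).  "The subgroup `Γ` generated by `g₁` and `g₂` induces
the group of translations `E[3] ≅ (ℤ/3ℤ)²`." [cite: ArtebaniDolgachev2009, §4; §2 (matrix2)] -/
theorem hesse_three_torsion_eq {L : Type u} [Field L] [IsAlgClosed L] {μ : L}
    (vec : (𝐖[μ] : WeierstrassCurve L).toAffine.Point → Fin 3 → L) {ω : L}
    {T₁ T₃ : (𝐖[μ] : WeierstrassCurve L).toAffine.Point} {c₁ c₃ : L}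
    (h3 : (3 : L) ≠ 0) (hμ : μ ^ 3 ≠ 1) (hω : ω ^ 2 + ω + 1 = 0) (hv0 : vec 0 = ![0, 1, 0])
    (hvs : ∀ x y (h : (𝐖[μ] : WeierstrassCurve L).toAffine.Nonsingular x y), vec (.some x y h) = ![x, y, 1])
    (hc₁ : c₁ ≠ 0) (hT₁ : (𝐍[μ] : Matrix (Fin 3) (Fin 3) L) *ᵥ vec T₁ = c₁ • ![(0 : L), 1, -ω])
    (hc₃ : c₃ ≠ 0) (hT₃ : (𝐍[μ] : Matrix (Fin 3) (Fin 3) L) *ᵥ vec T₃ = c₃ • ![(1 : L), 0, -1])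
    (R : (𝐖[μ] : WeierstrassCurve L).toAffine.Point) (hR : 3 • R = 0) :
    ∃ a b : ℕ, a < 3 ∧ b < 3 ∧ R = a • T₁ + b • T₃ := by
  have h3ω : ω ^ 3 = 1 := by linear_combination (ω - 1) * hω
  haveI : (𝐖[μ] : WeierstrassCurve L).IsElliptic := (hesse_weierstrass_isElliptic_iff h3 μ).2 hμ
  -- the `3`-torsion as a finite set of nine
  set T3 : Set (𝐖[μ] : WeierstrassCurve L).toAffine.Point :=
    SetLike.coe (AddSubgroup.torsionBy (𝐖[μ] : WeierstrassCurve L).toAffine.Point 3) with hT3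
  have hcard : Nat.card (AddSubgroup.torsionBy (𝐖[μ] : WeierstrassCurve L).toAffine.Point 3) = 9 :=
    card_torsionBy_three _ h3
  have hT3n : T3.ncard = 9 := by rw [hT3, ← Nat.card_coe_set_eq, SetLike.coe_sort_coe, hcard]
  have mem3 : ∀ Q : (𝐖[μ] : WeierstrassCurve L).toAffine.Point,
      Q ∈ AddSubgroup.torsionBy (𝐖[μ] : WeierstrassCurve L).toAffine.Point 3 ↔ (3 : ℕ) • Q = 0 :=
    fun Q => AddSubgroup.torsionBy.nsmul_iff
  have hT3f : T3.Finite := Set.finite_of_ncard_ne_zero (by rw [hT3n]; norm_num)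
  -- the nine combinations, as the image of `{0,1,2}²`
  set f : ℕ × ℕ → (𝐖[μ] : WeierstrassCurve L).toAffine.Point := fun x => x.1 • T₁ + x.2 • T₃ with hf
  set D : Finset (ℕ × ℕ) := Finset.range 3 ×ˢ Finset.range 3 with hD
  have hinj : Set.InjOn f D := by
    intro x hx y hy hxy
    simp only [hD, Finset.coe_product, Finset.coe_range, Set.mem_prod, Set.mem_Iio] at hx hy
    obtain ⟨e1, e2⟩ := hesse_torsion_pair_injective vec h3 hμ hω hv0 hvs hc₁ hT₁ hc₃ hT₃
      hx.1 hx.2 hy.1 hy.2 hxy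
    exact Prod.ext e1 e2
  have hS9 : (D.image f).card = 9 := by
    rw [Finset.card_image_of_injOn hinj, hD, Finset.card_product, Finset.card_range]
  have hsub : D.image f ⊆ hT3f.toFinset := by
    intro P hP
    rw [Finset.mem_image] at hP
    obtain ⟨x, -, rfl⟩ := hP
    rw [Set.Finite.mem_toFinset, hT3, SetLike.mem_coe, mem3]
    exact three_nsmul_basePoints vec h3 hμ h3ω hv0 hvs hc₁ hT₁ hc₃ hT₃ x.1 x.2
  have heq : D.image f = hT3f.toFinset :=
    Finset.eq_of_subset_of_card_le hsub (by rw [hS9, ← Set.ncard_eq_toFinset_card T3 hT3f, hT3n])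
  -- `R ∈ T3`
  have hRm : R ∈ hT3f.toFinset := by
    rw [Set.Finite.mem_toFinset, hT3, SetLike.mem_coe, mem3]; exact hR
  rw [← heq, Finset.mem_image] at hRm
  obtain ⟨x, hx, hxR⟩ := hRm
  rw [hD, Finset.mem_product, Finset.mem_range, Finset.mem_range] at hx
  exact ⟨x.1, x.2, hx.1, hx.2, hxR.symm⟩

/-! ## §4 Prop. 5.2, first assertion, as an equivalence over `K̄` -/

open scoped Classical in
/-- **Artebani–Dolgachev, Prop. 5.2 (first assertion) over `K = K̄`: "The union of the eight cubics
`Bᵢ` cuts out on each nonsingular member of the Hesse pencil the set of points of order `9` in the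
group law with the point `p₀` as the origin."**  For `P ∈ W_μ(K̄)` (`3 ≠ 0`, `μ³ ≠ 1`,
`ω² + ω + 1 = 0`, `T₁, T₃` over `p₁, p₃`) with Hesse point `p = N vec P`: `P` has order `9` iff
`p ∈ B₁ ∪ B₅ ∪ B₆ ∪ B₂ ∪ B₇ ∪ B₈ ∪ B₄ ∪ B₃`.  (`←` is g20-#4 `hesse_addOrderOf_eq_nine` over any
field; `→`: `3P` is a non-zero `3`-torsion point, hence `aT₁ + bT₃` with `(a,b) ≠ (0,0)` by §3, and
`3P + (−(aT₁ + bT₃)) = O` puts `p` on the matching cubic by g20-#4 `hesse_B_eq_zero_iff`.)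
Stated with classical decidability on `L`, as `card_torsionBy_three` is.
[cite: ArtebaniDolgachev2009, §5, Prop. 5.2 (first assertion)] -/
theorem hesse_addOrderOf_eq_nine_iff {L : Type u} [Field L] [IsAlgClosed L] {μ : L}
    (vec : (𝐖[μ] : WeierstrassCurve L).toAffine.Point → Fin 3 → L) {ω : L}
    {T₁ T₃ : (𝐖[μ] : WeierstrassCurve L).toAffine.Point} {c₁ c₃ : L}
    (h3 : (3 : L) ≠ 0) (hμ : μ ^ 3 ≠ 1) (hω : ω ^ 2 + ω + 1 = 0) (hv0 : vec 0 = ![0, 1, 0])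
    (hvs : ∀ x y (h : (𝐖[μ] : WeierstrassCurve L).toAffine.Nonsingular x y), vec (.some x y h) = ![x, y, 1])
    (hc₁ : c₁ ≠ 0) (hT₁ : (𝐍[μ] : Matrix (Fin 3) (Fin 3) L) *ᵥ vec T₁ = c₁ • ![(0 : L), 1, -ω])
    (hc₃ : c₃ ≠ 0) (hT₃ : (𝐍[μ] : Matrix (Fin 3) (Fin 3) L) *ᵥ vec T₃ = c₃ • ![(1 : L), 0, -1])
    (P : (𝐖[μ] : WeierstrassCurve L).toAffine.Point) :
    addOrderOf P = 9 ↔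
      (eval ((𝐍[μ] : Matrix (Fin 3) (Fin 3) L) *ᵥ vec P) 𝐁₁[ω] = 0 ∨
      eval ((𝐍[μ] : Matrix (Fin 3) (Fin 3) L) *ᵥ vec P) 𝐁₅[ω] = 0 ∨
      eval ((𝐍[μ] : Matrix (Fin 3) (Fin 3) L) *ᵥ vec P) (𝐁₆ : MvPolynomial (Fin 3) L) = 0 ∨
      eval ((𝐍[μ] : Matrix (Fin 3) (Fin 3) L) *ᵥ vec P) (𝐁₂ : MvPolynomial (Fin 3) L) = 0 ∨
      eval ((𝐍[μ] : Matrix (Fin 3) (Fin 3) L) *ᵥ vec P) 𝐁₇[ω] = 0 ∨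
      eval ((𝐍[μ] : Matrix (Fin 3) (Fin 3) L) *ᵥ vec P) 𝐁₈[ω] = 0 ∨
      eval ((𝐍[μ] : Matrix (Fin 3) (Fin 3) L) *ᵥ vec P) 𝐁₄[ω] = 0 ∨
      eval ((𝐍[μ] : Matrix (Fin 3) (Fin 3) L) *ᵥ vec P) 𝐁₃[ω] = 0) := by
  refine ⟨fun h9 => ?_, hesse_addOrderOf_eq_nine vec h3 hμ hω hv0 hvs hc₁ hT₁ hc₃ hT₃ P⟩
  have h3ω : ω ^ 3 = 1 := by linear_combination (ω - 1) * hω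
  have e₁ := three_nsmul_T₁ vec h3 hμ h3ω hv0 hvs hc₁ hT₁
  have e₃ := three_nsmul_T₃ vec h3 hμ hv0 hvs hc₃ hT₃
  obtain ⟨b₁, b₅, b₆, b₂, b₇, b₈, b₄, b₃⟩ := hesse_B_eq_zero_iff vec h3 hμ hω hv0 hvs hc₁ hT₁ hc₃ hT₃ P
  -- `3P` is a non-zero `3`-torsion point
  have h9P : (3 * 3) • P = 0 := by rw [show 3 * 3 = addOrderOf P by rw [h9]]; exact addOrderOf_nsmul_eq_zero P
  have hR3 : 3 • (3 • P) = 0 := by rwa [← mul_nsmul]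
  have hR0 : 3 • P ≠ 0 := by
    intro h0
    have := addOrderOf_dvd_of_nsmul_eq_zero h0
    rw [h9] at this
    omega
  obtain ⟨a, b, ha, hb, hab⟩ := hesse_three_torsion_eq vec h3 hμ hω hv0 hvs hc₁ hT₁ hc₃ hT₃ (3 • P) hR3
  -- `3P + (−(aT₁ + bT₃)) = 0`, the inverse being `((3−a) mod 3)T₁ + ((3−b) mod 3)T₃`
  have hsum : 3 • P + (((3 - a) % 3) • T₁ + ((3 - b) % 3) • T₃) = 0 := by
    rw [← neg_torsion_pair e₁ e₃ ha hb, hab, add_neg_cancel]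
  have hab0 : ¬(a = 0 ∧ b = 0) := by
    rintro ⟨rfl, rfl⟩; apply hR0; rw [hab]; simp
  interval_cases a <;> interval_cases b <;> simp only [Nat.reduceSub, Nat.reduceMod, one_nsmul,
    zero_nsmul, add_zero, zero_add] at hsum
  · exact absurd ⟨rfl, rfl⟩ hab0
  · exact Or.inr (Or.inr (Or.inr (Or.inl (b₂.2 hsum))))
  · exact Or.inr (Or.inr (Or.inl (b₆.2 hsum)))
  · exact Or.inr (Or.inl (b₅.2 hsum))
  · exact Or.inr (Or.inr (Or.inr (Or.inr (Or.inr (Or.inr (Or.inr (b₃.2 hsum)))))))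
  · exact Or.inr (Or.inr (Or.inr (Or.inr (Or.inr (Or.inl (b₈.2 hsum))))))
  · exact Or.inl (b₁.2 hsum)
  · exact Or.inr (Or.inr (Or.inr (Or.inr (Or.inr (Or.inr (Or.inl (b₄.2 hsum)))))))
  · exact Or.inr (Or.inr (Or.inr (Or.inr (Or.inl (b₇.2 hsum)))))

end Hesse

end Literature.AlgebraicGeometry.PlaneCurves
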